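/-
Copyright (c) 2026 the pub-hodgecm-mathlib formalisation cell (harness21).  Prover seat hodgecm-mathlib-B-p14 (g36): road «S3-tree» (chair F0P3a-plan (g11); architect A-p16 (g30) A-88 (4);
T10-42 (3) S3-res capital), brick T1 «the `U(3)_v` tree», DATUM-FREE EDITION R5c = THE LATTICE GRAPH IS A TREE FOR ANY ISOMETRIC INVOLUTION, GIVEN THE FRAMES; 2026-09-01.
Twin of ★ T1d-C3 `UnitaryLatticeTreeIsTree` with `hd, htr₂ ↦ (hσ, hvσ, hϖ, hfr₀, hfr₂)`.
-/
import Literature.NumberTheory.Automorphic.UnitaryLatticeTreeTypeTwoParentOfInvolution   -- ★ T1 R5b (B-p14 (g36)): `latticeParent_spec_of_isVertexLattice_two_of_frame`; brings ★ R5a `…_of_isSelfDualLattice_of_frame`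
import Literature.NumberTheory.Automorphic.UnitaryLatticeTreeIsTree                     -- ★ T1d-C3 (B-p14 (g35)): depth witnesses `exists_scaleLattice_pow_stdLattice_le_of_isVertexLattice`, `v_det_antidiagonal_three`; brings ★ `RootedTree.isTree_of_parent`
import HarnessLib

/-!
# The lattice graph of a hermitian space — T1 FILE R5c: THE LATTICE GRAPH OF `(K³, J₀)` IS A TREE FOR ANY ISOMETRIC INVOLUTION, GIVEN THE FRAMES
# (Bruhat–Tits 1972 §10; Tits 1979 §2.4, §3.3.3; Serre *Trees* II.1.1, I.2.2 Prop. 8)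

Topic `NumberTheory/Automorphic`; namespace `Literature.NumberTheory.Automorphic.UnitaryLatticeTree`.  THEOREMS ONLY (no definition, no instance, no notation, no named fact,
no `sorry`); kernel lane.  Cell `pub/hodgecm-mathlib` (D-0151), crux H413 = `stmt-HodgeConjecture-24833`; road «S3-tree», brick T1 «the `U(3)_v` lattice graph is a TREE»,
DATUM-FREE EDITION, file 3 (after ★ R5a, R5b).  ★ `isTree_latticeGraph_three (hd) (htr₂)` is the unramified tree theorem; its proof (the rooted criterion ★ `RootedTree.isTree_of_parent`
with root `𝒪³`, level `2·depth` ∕ `2·depth − 1`, parent ★ `latticeParent`) uses the datum only through the two `latticeParent` specs, which ★ R5a∕R5b now prove for ANY involution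
`σ` preserving `v` GIVEN THE FRAMES of the vertices: `hfr₀` = every self-dual vertex is `κ·latt diag(ϖ^a,1,ϖ^{−a})` (`κ ∈ K₀`, `a : ℤ`), `hfr₂` = every type-two vertex is
`κ·t·κ″·N₁` (`κ, κ″ ∈ K₀`, `t = diag(ϖ^a, 1, (σϖ)^{−a})`, `a : ℕ`).  Both frames follow from the Cartan decomposition `U = K₀·T·K₀` for any involution (★
`UnitaryGroup.exists_cartan_of_involution`) and the transitivity binders `htr₀`, `htr₂` (★ at unramified and at tame-ramified places); that discharge is the next file, so that
this one stays in the pure `[Valued K ℤᵐ⁰]` currency.  CONSEQUENCE (with ★ R4 `UnitaryLatticeTreeValencyRamified`): the binder `hT` of the tame-ramified sphere counts.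

* §1 `latticeParent_spec_of_isSelfDualLattice_of_frames`, `latticeParent_spec_of_isVertexLattice_two_of_frames` (the specs under the global frame binders).
* §2 `eq_latticeParent_of_lt_of_frames` («every edge is a parent edge», ★ §27 verbatim).
* §3 **`isTree_latticeGraph_three_of_frames (hσ) (hvσ) (hϖ) (hfr₀) (hfr₂) : (latticeGraph σ ϖ J₀).IsTree`** (★ §28 verbatim).

HONEST LABEL: HC_CM is proved only modulo the 2 remaining named inputs (hLiu418 24832, h413 24833) until rung 0 closes; nothing printed is asserted here (elementary lattice algebra +
the rooted criterion); the frames `hfr₀`, `hfr₂` are binders of this file.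

## References
* [BruhatTits1972] F. Bruhat, J. Tits, *Groupes réductifs sur un corps local I*, Publ. Math. IHÉS 41 (1972), §10.
* [Tits1979] J. Tits, *Reductive groups over local fields*, PSPM 33.1 (1979), §2.4, §3.3.3.
* [Serre1980Trees] J.-P. Serre, *Trees* (1980), Ch. II §1.1; Ch. I §2.2 Prop. 8.
* [Jacobowitz1962] R. Jacobowitz, *Hermitian forms over local fields*, Amer. J. Math. 84 (1962), §7–§8.
-/

set_option autoImplicit false

noncomputable section

open scoped Valued WithZero Matrix MatrixGroups

namespace Literature.NumberTheory.Automorphic.UnitaryLatticeTree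

open Literature.NumberTheory.Automorphic Literature.NumberTheory.Automorphic.HermitianLattice
open Literature.NumberTheory.Automorphic.CartanUnique

variable {K : Type*} [Field K] [Valued K ℤᵐ⁰] {σ : K →+* K} {ϖ : K}

/-! ## §1 The two `latticeParent` specs under the global frame binders -/

/-- **The parent of a self-dual vertex `L ≠ 𝒪³`** (any isometric involution, given `hfr₀`): `depth L ≥ 1`, the parent is of type `2`, strictly below, of the same depth (★ R5a).
[cite: BruhatTits1972, §10] [cite: Serre1980Trees, II.1.1] -/
theorem latticeParent_spec_of_isSelfDualLattice_of_frames (hσ : ∀ x, σ (σ x) = x) (hvσ : ∀ a, Valued.v (σ a) = Valued.v a) (hϖ : Valued.v ϖ = WithZero.exp (-1 : ℤ))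
    (hfr₀ : ∀ L : Submodule 𝒪[K] (Fin 3 → K), IsSelfDualLattice σ ϖ ((StdForm.antidiagonal 3).over K) L → ∃ κ : unitaryGroupOfForm σ ((StdForm.antidiagonal 3).over K), κ ∈ unitaryInt σ ((StdForm.antidiagonal 3).over K) ∧ ∃ a : ℤ, L = mapGL (κ : GL (Fin 3) K) (latt (Matrix.diagonal ![ϖ ^ a, 1, ϖ ^ (-a)]))) {L : Submodule 𝒪[K] (Fin 3 → K)}
    (hL : IsSelfDualLattice σ ϖ ((StdForm.antidiagonal 3).over K) L) (hL0 : L ≠ stdLattice K 3) :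
    1 ≤ latticeDepth ϖ L ∧
    IsVertexLattice σ ϖ ((StdForm.antidiagonal 3).over K) 2 (latticeParent σ ϖ ((StdForm.antidiagonal 3).over K) L) ∧
    latticeParent σ ϖ ((StdForm.antidiagonal 3).over K) L < L ∧
    latticeDepth ϖ (latticeParent σ ϖ ((StdForm.antidiagonal 3).over K) L) = latticeDepth ϖ L := by
  obtain ⟨κ, hκ, a, rfl⟩ := hfr₀ L hL
  exact latticeParent_spec_of_isSelfDualLattice_of_frame hσ hvσ hϖ hκ a hL0

/-- **The parent of a type-two vertex** (any isometric involution, given `hfr₂`): self-dual, strictly above, `depth(parent) + 1 = depth` (★ R5b).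
[cite: BruhatTits1972, §10] [cite: Serre1980Trees, II.1.1] -/
theorem latticeParent_spec_of_isVertexLattice_two_of_frames (hσ : ∀ x, σ (σ x) = x) (hvσ : ∀ a, Valued.v (σ a) = Valued.v a) (hϖ : Valued.v ϖ = WithZero.exp (-1 : ℤ))
    (hfr₂ : ∀ M : Submodule 𝒪[K] (Fin 3 → K), IsVertexLattice σ ϖ ((StdForm.antidiagonal 3).over K) 2 M → ∃ κ : unitaryGroupOfForm σ ((StdForm.antidiagonal 3).over K), κ ∈ unitaryInt σ ((StdForm.antidiagonal 3).over K) ∧ ∃ κ'' : unitaryGroupOfForm σ ((StdForm.antidiagonal 3).over K), κ'' ∈ unitaryInt σ ((StdForm.antidiagonal 3).over K) ∧ ∃ a : ℕ, ∃ t : unitaryGroupOfForm σ ((StdForm.antidiagonal 3).over K), ((t : GL (Fin 3) K) : Matrix (Fin 3) (Fin 3) K) = Matrix.diagonal ![ϖ ^ (a : ℤ), 1, (σ ϖ) ^ (-(a : ℤ))] ∧ M = mapGL (κ : GL (Fin 3) K) (mapGL (t : GL (Fin 3) K) (mapGL (κ'' : GL (Fin 3) K) (latt (Matrix.diagonal ![(1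 : K), 1, ϖ]))))) {M : Submodule 𝒪[K] (Fin 3 → K)} (hM : IsVertexLattice σ ϖ ((StdForm.antidiagonal 3).over K) 2 M) :
    IsSelfDualLattice σ ϖ ((StdForm.antidiagonal 3).over K) (latticeParent σ ϖ ((StdForm.antidiagonal 3).over K) M) ∧
      M < latticeParent σ ϖ ((StdForm.antidiagonal 3).over K) M ∧
      latticeDepth ϖ (latticeParent σ ϖ ((StdForm.antidiagonal 3).over K) M) + 1 = latticeDepth ϖ M := by
  obtain ⟨κ, hκ, κ'', hκ'', a, t, ht, hMeq⟩ := hfr₂ M hM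
  exact latticeParent_spec_of_isVertexLattice_two_of_frame hσ hvσ hϖ hM hκ hκ'' ht hMeq

/-! ## §2 Every edge is a parent edge -/

/-- **EVERY EDGE IS A PARENT EDGE** (`N = 3`, any isometric involution, given the frames `hfr₀`, `hfr₂`): for vertices `N < L` of the lattice graph — so `N` is of type two and `L` self-dual (★ `type_of_lt_three`) —
the depths satisfy `depth L ≤ depth N ≤ depth L + 1`, and: if `depth N = depth L + 1` then `L = latticeParent N` ((D3) and (D1)); if `depth N = depth L` then
`L ≠ 𝒪³` and `N = latticeParent L` ((D4) and (D2)). [cite: Serre1980Trees, II.1.1] [cite: BruhatTits1972, §10] -/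
theorem eq_latticeParent_of_lt_of_frames (hσ : ∀ x, σ (σ x) = x) (hvσ : ∀ a, Valued.v (σ a) = Valued.v a) (hϖ : Valued.v ϖ = WithZero.exp (-1 : ℤ))
    (hfr₀ : ∀ L : Submodule 𝒪[K] (Fin 3 → K), IsSelfDualLattice σ ϖ ((StdForm.antidiagonal 3).over K) L → ∃ κ : unitaryGroupOfForm σ ((StdForm.antidiagonal 3).over K), κ ∈ unitaryInt σ ((StdForm.antidiagonal 3).over K) ∧ ∃ a : ℤ, L = mapGL (κ : GL (Fin 3) K) (latt (Matrix.diagonal ![ϖ ^ a, 1, ϖ ^ (-a)])))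
    (hfr₂ : ∀ M : Submodule 𝒪[K] (Fin 3 → K), IsVertexLattice σ ϖ ((StdForm.antidiagonal 3).over K) 2 M → ∃ κ : unitaryGroupOfForm σ ((StdForm.antidiagonal 3).over K), κ ∈ unitaryInt σ ((StdForm.antidiagonal 3).over K) ∧ ∃ κ'' : unitaryGroupOfForm σ ((StdForm.antidiagonal 3).over K), κ'' ∈ unitaryInt σ ((StdForm.antidiagonal 3).over K) ∧ ∃ a : ℕ, ∃ t : unitaryGroupOfForm σ ((StdForm.antidiagonal 3).over K), ((t : GL (Fin 3) K) : Matrix (Fin 3) (Fin 3) K) = Matrix.diagonal ![ϖ ^ (a : ℤ), 1, (σ ϖ) ^ (-(a : ℤ))] ∧ M = mapGL (κ : GL (Fin 3) K) (mapGL (t : GL (Fin 3) K) (mapGL (κ'' : GL (Fin 3) K) (latt (Matrix.diagonal ![(1 : K), 1, ϖ])))))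
    {N L : Submodule 𝒪[K] (Fin 3 → K)} (hN : IsVertex σ ϖ ((StdForm.antidiagonal 3).over K) N) (hL : IsVertex σ ϖ ((StdForm.antidiagonal 3).over K) L)
    (hlt : N < L) :
    L = latticeParent σ ϖ ((StdForm.antidiagonal 3).over K) N ∨ (L ≠ stdLattice K 3 ∧ N = latticeParent σ ϖ ((StdForm.antidiagonal 3).over K) L) := by
  have hϖ0 : ϖ ≠ 0 := uniformizer_ne_zero hϖ
  obtain ⟨dN, hN⟩ := hN
  obtain ⟨dL, hL⟩ := hL
  obtain ⟨rfl, rfl⟩ := type_of_lt_three hvσ hϖ v_det_antidiagonal_three hN hL hlt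
  -- the two parents
  obtain ⟨hPNsd, hNlt, hdepN⟩ := latticeParent_spec_of_isVertexLattice_two_of_frames hσ hvσ hϖ hfr₂ hN
  -- depth witnesses and the squeeze `depth L ≤ depth N ≤ depth L + 1`
  obtain ⟨jN, hjN⟩ := exists_scaleLattice_pow_stdLattice_le_of_isVertexLattice hϖ hN
  obtain ⟨jL, hjL⟩ := exists_scaleLattice_pow_stdLattice_le_of_isVertexLattice hϖ hL
  have hwN := scaleLattice_latticeDepth_le hjN
  have hwL := scaleLattice_latticeDepth_le hjL
  have hle1 : latticeDepth ϖ L ≤ latticeDepth ϖ N := latticeDepth_le_of_le (hwN.trans hlt.le)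
  have hle2 : latticeDepth ϖ N ≤ latticeDepth ϖ L + 1 :=
    latticeDepth_le_of_le ((scaleLattice_pow_succ_stdLattice_le hwL).trans (scaleLattice_le_of_lt hvσ isUnit_det_antidiagonal ⟨2, hN⟩ hL hlt.le))
  have hLsd : dualLatt σ ((StdForm.antidiagonal 3).over K) L = L := dualLatt_eq_self_of_isSelfDualLattice hvσ isUnit_det_antidiagonal hL
  rcases (show latticeDepth ϖ N = latticeDepth ϖ L + 1 ∨ latticeDepth ϖ N = latticeDepth ϖ L by omega) with hcase | hcase
  · -- `N` is deeper: `L ≤ N^♯ ⊓ ϖ^{1 − depth N}𝒪³ = latticeParent N`, then (D1)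
    left
    refine eq_of_le_of_isVertexLattice hvσ hϖ0 hL hPNsd (le_inf ?_ ?_)
    · rw [← hLsd]; exact dualLatt_antitone σ _ hlt.le
    · have h := le_scaleLattice_of_isVertexLattice hvσ hϖ0 isUnit_det_antidiagonal isIntMatrix_antidiagonal isIntMatrix_antidiagonal_inv hL hwL
      rwa [hcase, Nat.cast_add, Nat.cast_one, show (1 : ℤ) - ((latticeDepth ϖ L : ℤ) + 1) = -(latticeDepth ϖ L : ℤ) by ring, zpow_neg, zpow_natCast]
  · -- same depth: `L ≠ 𝒪³` (depth `N ≥ 1`) and `N ≤ L^♯ ⊓ ϖ^{1 − depth L}𝒪³ = latticeParent L`, then (D2)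
    right
    have hL0 : L ≠ stdLattice K 3 := by
      rintro rfl
      rw [latticeDepth_stdLattice] at hcase
      omega
    obtain ⟨-, hPL2, -, -⟩ := latticeParent_spec_of_isSelfDualLattice_of_frames hσ hvσ hϖ hfr₀ hL hL0
    refine ⟨hL0, eq_of_le_of_isVertexLattice hvσ hϖ0 hN hPL2 (le_inf ?_ ?_)⟩
    · rw [hLsd]; exact hlt.le
    · rw [← hcase]; exact hNlt.le.trans inf_le_right

/-! ## §28 The lattice graph of `(K³, J₀)` is a tree -/

/-- **THE LATTICE GRAPH OF THE SPLIT HERMITIAN SPACE `(K³, J₀)` IS A TREE, FOR ANY ISOMETRIC INVOLUTION** — the Bruhat–Tits tree of the quasi-split `U(3)` (unramified OR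
ramified `K ∕ K^σ`) in the lattice model of ★ T1a, GIVEN the frames `hfr₀` (every self-dual vertex is `κ·L_a`) and `hfr₂` (every type-two vertex is `κ·t·κ″·N₁`), both supplied by the
Cartan decomposition for any involution + transitivity (filed separately).
Proof: ★ `RootedTree.isTree_of_parent` with root `𝒪³`, level `2·depth` ∕ `2·depth − 1`, parent ★ `latticeParent`; the parent axioms are ★ `latticeParent_spec_of_isSelfDualLattice`
and ★ `latticeParent_spec_of_isVertexLattice_two`, the edge axiom is `eq_latticeParent_of_lt`.  This is the hypothesis `hT` of ★ `TreeDisplacement` for `U(3)`.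
[cite: BruhatTits1972, §10] [cite: Tits1979, §3.3.3] [cite: Serre1980Trees, II.1.1] -/
theorem isTree_latticeGraph_three_of_frames (hσ : ∀ x, σ (σ x) = x) (hvσ : ∀ a, Valued.v (σ a) = Valued.v a) (hϖ : Valued.v ϖ = WithZero.exp (-1 : ℤ))
    (hfr₀ : ∀ L : Submodule 𝒪[K] (Fin 3 → K), IsSelfDualLattice σ ϖ ((StdForm.antidiagonal 3).over K) L → ∃ κ : unitaryGroupOfForm σ ((StdForm.antidiagonal 3).over K), κ ∈ unitaryInt σ ((StdForm.antidiagonal 3).over K) ∧ ∃ a : ℤ, L = mapGL (κ : GL (Fin 3) K) (latt (Matrix.diagonal ![ϖ ^ a, 1, ϖ ^ (-a)])))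
    (hfr₂ : ∀ M : Submodule 𝒪[K] (Fin 3 → K), IsVertexLattice σ ϖ ((StdForm.antidiagonal 3).over K) 2 M → ∃ κ : unitaryGroupOfForm σ ((StdForm.antidiagonal 3).over K), κ ∈ unitaryInt σ ((StdForm.antidiagonal 3).over K) ∧ ∃ κ'' : unitaryGroupOfForm σ ((StdForm.antidiagonal 3).over K), κ'' ∈ unitaryInt σ ((StdForm.antidiagonal 3).over K) ∧ ∃ a : ℕ, ∃ t : unitaryGroupOfForm σ ((StdForm.antidiagonal 3).over K), ((t : GL (Fin 3) K) : Matrix (Fin 3) (Fin 3) K) = Matrix.diagonal ![ϖ ^ (a : ℤ), 1, (σ ϖ) ^ (-(a : ℤ))] ∧ M = mapGL (κ : GL (Fin 3) K) (mapGL (t : GL (Fin 3) K) (mapGL (κ'' : GL (Fin 3) K) (latt (Matrix.diagonal ![(1 : K), 1, ϖ]))))) :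
    (latticeGraph σ ϖ ((StdForm.antidiagonal 3).over K)).IsTree := by
  classical
  have hroot : IsSelfDualLattice σ ϖ ((StdForm.antidiagonal 3).over K) (stdLattice K 3) := isSelfDualLattice_stdLattice_three_of_v hϖ
  let V := {M : Submodule 𝒪[K] (Fin 3 → K) // IsVertex σ ϖ ((StdForm.antidiagonal 3).over K) M}
  let r : V := ⟨stdLattice K 3, ⟨0, hroot⟩⟩
  let dp : V → ℕ := fun v => if IsSelfDualLattice σ ϖ ((StdForm.antidiagonal 3).over K) v.1 then 2 * latticeDepth ϖ v.1 else 2 * latticeDepth ϖ v.1 - 1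
  let p : V → V := fun v => if hv : IsVertex σ ϖ ((StdForm.antidiagonal 3).over K) (latticeParent σ ϖ ((StdForm.antidiagonal 3).over K) v.1) then
    ⟨latticeParent σ ϖ ((StdForm.antidiagonal 3).over K) v.1, hv⟩ else v
  -- no lattice is both self-dual and of type two
  have hnot : ∀ M : Submodule 𝒪[K] (Fin 3 → K), IsVertexLattice σ ϖ ((StdForm.antidiagonal 3).over K) 2 M → ¬ IsSelfDualLattice σ ϖ ((StdForm.antidiagonal 3).over K) M :=
    fun M h2 h0 => absurd (type_unique hvσ hϖ h2 h0) (by norm_num)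
  -- the parent axioms
  have hpval : ∀ v : V, v ≠ r → (p v).1 = latticeParent σ ϖ ((StdForm.antidiagonal 3).over K) v.1 ∧
      (latticeGraph σ ϖ ((StdForm.antidiagonal 3).over K)).Adj v (p v) ∧ dp (p v) + 1 = dp v := by
    intro v hv
    have hv0 : v.1 ≠ stdLattice K 3 := fun h => hv (Subtype.ext h)
    obtain ⟨d, hvd⟩ := v.2
    rcases type_eq_zero_or_two_of_isVertexLattice_three hvσ hϖ v_det_antidiagonal_three hvd with rfl | rfl
    · -- `v` self-dual, `v ≠ 𝒪³`: parent of type two, below `v`, same depth `≥ 1`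
      obtain ⟨hk, hP2, hPlt, hdep⟩ := latticeParent_spec_of_isSelfDualLattice_of_frames hσ hvσ hϖ hfr₀ hvd hv0
      have hPv : IsVertex σ ϖ ((StdForm.antidiagonal 3).over K) (latticeParent σ ϖ ((StdForm.antidiagonal 3).over K) v.1) := ⟨2, hP2⟩
      have hpv : p v = ⟨latticeParent σ ϖ ((StdForm.antidiagonal 3).over K) v.1, hPv⟩ := dif_pos hPv
      refine ⟨by rw [hpv], ?_, ?_⟩
      · rw [hpv, latticeGraph_adj_iff]; exact Or.inr hPlt
      · simp only [dp, hpv, if_pos (show IsSelfDualLattice σ ϖ _ v.1 from hvd), if_neg (hnot _ hP2), hdep]; omega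
    · -- `v` of type two: parent self-dual, above `v`, one depth up
      obtain ⟨hP0, hltP, hdep⟩ := latticeParent_spec_of_isVertexLattice_two_of_frames hσ hvσ hϖ hfr₂ hvd
      have hPv : IsVertex σ ϖ ((StdForm.antidiagonal 3).over K) (latticeParent σ ϖ ((StdForm.antidiagonal 3).over K) v.1) := ⟨0, hP0⟩
      have hpv : p v = ⟨latticeParent σ ϖ ((StdForm.antidiagonal 3).over K) v.1, hPv⟩ := dif_pos hPv
      refine ⟨by rw [hpv], ?_, ?_⟩
      · rw [hpv, latticeGraph_adj_iff]; exact Or.inl hltP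
      · simp only [dp, hpv, if_pos (show IsSelfDualLattice σ ϖ _ (latticeParent σ ϖ _ v.1) from hP0), if_neg (hnot _ hvd)]; omega
  refine Literature.Combinatorics.SimpleGraph.RootedTree.isTree_of_parent r dp p (fun v hv => (hpval v hv).2) ?_
  -- every edge is a parent edge (§27)
  have hkey : ∀ v w : V, v.1 < w.1 → (v ≠ r ∧ p v = w) ∨ (w ≠ r ∧ p w = v) := by
    intro v w hvw
    rcases eq_latticeParent_of_lt_of_frames hσ hvσ hϖ hfr₀ hfr₂ v.2 w.2 hvw with hpar | ⟨hw0, hpar⟩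
    · left
      have hv : v ≠ r := by
        intro h
        obtain ⟨d, hvd⟩ := v.2
        obtain ⟨d', hwd⟩ := w.2
        obtain ⟨rfl, -⟩ := type_of_lt_three hvσ hϖ v_det_antidiagonal_three hvd hwd hvw
        exact hnot _ hvd (by rw [show v.1 = stdLattice K 3 from congrArg Subtype.val h]; exact hroot)
      exact ⟨hv, Subtype.ext (by rw [(hpval v hv).1]; exact hpar.symm)⟩
    · right
      have hw : w ≠ r := fun h => hw0 (congrArg Subtype.val h)
      exact ⟨hw, Subtype.ext (by rw [(hpval w hw).1]; exact hpar.symm)⟩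
  intro v w hvw
  rw [latticeGraph_adj_iff] at hvw
  rcases hvw with h | h
  · exact hkey v w h
  · exact (hkey w v h).symm

end Literature.NumberTheory.Automorphic.UnitaryLatticeTree

end
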